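import Literature.RingTheory.Nullstellensatz.EffectiveNullstellensatz
import Literature.LinearAlgebra.Subspace.RankDichotomy
import Mathlib.FieldTheory.IsAlgClosed.Basic
import HarnessLib

/-!
# Coordinate projections of an affine variety: finite or cofinite, with explicit bounds

Topic `Literature/RingTheory/Nullstellensatz`. Let `K` be an algebraically closed field of
characteristic zero and `S_1, …, S_s ∈ K[Y_1, …, Y_n]` of degree `≤ d` (`d ≥ 1`) with zero set
`Z`. For a coordinate `j`, the fibre `Z ∩ {Y_j = a}` is empty iff (effective Nullstellensatz,
`exists_sum_mul_eq_one_of_forall_exists_ne_zero`) `1 = ∑ g_i S_i + g_0 (Y_j - a)` with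
`deg g ≤ E = effNSBound n d`, i.e. iff `1` lies in the image of the affine pencil of linear maps
`g ↦ ∑ g_i S_i + g_0 Y_j - a g_0` on polynomials of degree `≤ E`; so the rank dichotomy
(`Literature.LinearAlgebra.Subspace.rank_dichotomy`) gives: **the projection `π_j(Z)` has at most
`N` elements, or misses at most `N` elements of `K`**, `N = (E + d + 1)^n`
(`projection_dichotomy`). Consequently (`exists_constraints_smallProj`) one can add at most `n`
equations `Y_j = a` with NATURAL numbers `a ≤ N` keeping the zero set nonempty and making every
coordinate projection of it a set of at most `N` elements (in particular the constrained zero set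
is finite). This is the "fix coordinates to small integers" step of an elementary proof of the
existence of algebraic points of small degree and height on a nonempty variety (Bürgisser 2000
TCS, Thm. 4.5, there via Krick–Pardo); the classical qualitative statement is Chevalley's theorem
on constructible images.

## Contents (namespace `Literature.RingTheory.Nullstellensatz`, everything proved)

* `zeroSet`, `projBound` — the zero set of a family and the bound `N = (effNSBound n d + d + 1)^n`;
* `fibrePencil₀`, `fibrePencil₁`, `one_mem_range_fibrePencil_iff` — the pencil and the
  equivalence "fibre empty ⟺ `1 ∈ im M(a)`";
* `projection_dichotomy` — `π_j(Z)` small or co-small;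
* `SmallProj`, `exists_constraints_smallProj` — the iteration.
-/

noncomputable section

open MvPolynomial Module
open scoped Classical

namespace Literature.RingTheory.Nullstellensatz

open Literature.LinearAlgebra.Subspace

variable {K : Type*} [Field K]

/-- The zero set of a family of polynomials. [folklore] -/
def zeroSet {n s : ℕ} (S : Fin s → MvPolynomial (Fin n) K) : Set (Fin n → K) :=
  {x | ∀ i, eval x (S i) = 0}

/-- Membership in the zero set. [folklore] -/
theorem mem_zeroSet {n s : ℕ} {S : Fin s → MvPolynomial (Fin n) K}
    {x : Fin n → K} : x ∈ zeroSet S ↔ ∀ i, eval x (S i) = 0 := Iff.rfl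

/-- The bound `N = (E + d + 1)^n`, `E = effNSBound n d`, for the number of (or of missing) values of
a coordinate on a zero set. [folklore] -/
def projBound (n d : ℕ) : ℕ := (effNSBound n d + d + 1) ^ n

/-! ### The pencil attached to a coordinate -/

section Pencil

variable {n s : ℕ} (S : Fin s → MvPolynomial (Fin n) K) (d : ℕ) (j : Fin n)

/-- The source of the pencil: `s + 1` polynomials of degree `≤ E`. [folklore] -/
abbrev PencilSrc (n s d : ℕ) (K : Type*) [Field K] : Type _ :=
  Fin (s + 1) → ↥(restrictTotalDegree (Fin n) K (effNSBound n d))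

/-- The target of the pencil: polynomials of degree `≤ E + d`. [folklore] -/
abbrev PencilTgt (n d : ℕ) (K : Type*) [Field K] : Type _ :=
  ↥(restrictTotalDegree (Fin n) K (effNSBound n d + d))

/-- The underlying polynomial-valued map `g ↦ ∑_{i<s} g_i S_i + g_s Y_j`. [folklore] -/
def fibreMap₀ : PencilSrc n s d K →ₗ[K] MvPolynomial (Fin n) K :=
  ∑ i : Fin s, (LinearMap.mulRight K (S i)).comp
      ((restrictTotalDegree (Fin n) K (effNSBound n d)).subtype.comp (LinearMap.proj i.castSucc)) +
    (LinearMap.mulRight K (X j)).comp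
      ((restrictTotalDegree (Fin n) K (effNSBound n d)).subtype.comp (LinearMap.proj (Fin.last s)))

/-- `fibreMap₀` evaluated. [folklore] -/
theorem fibreMap₀_apply (g : PencilSrc n s d K) :
    fibreMap₀ S d j g = ∑ i : Fin s, (g i.castSucc : MvPolynomial (Fin n) K) * S i +
      (g (Fin.last s) : MvPolynomial (Fin n) K) * X j := by
  simp [fibreMap₀]

/-- The underlying map `g ↦ -g_s`. [folklore] -/
def fibreMap₁ : PencilSrc n s d K →ₗ[K] MvPolynomial (Fin n) K :=
  -((restrictTotalDegree (Fin n) K (effNSBound n d)).subtype.comp (LinearMap.proj (Fin.last s)))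

/-- `fibreMap₁` evaluated. [folklore] -/
theorem fibreMap₁_apply (g : PencilSrc n s d K) :
    fibreMap₁ (s := s) d g = -(g (Fin.last s) : MvPolynomial (Fin n) K) := by
  simp [fibreMap₁]

/-- `fibreMap₀` lands in degree `≤ E + d`. [folklore] -/
theorem fibreMap₀_mem (hd : ∀ i, (S i).totalDegree ≤ d) (hd1 : 1 ≤ d) (g : PencilSrc n s d K) :
    fibreMap₀ S d j g ∈ restrictTotalDegree (Fin n) K (effNSBound n d + d) := by
  rw [fibreMap₀_apply]
  refine Submodule.add_mem _ (Submodule.sum_mem _ fun i _ => ?_) ?_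
  · rw [mem_restrictTotalDegree]
    exact (totalDegree_mul _ _).trans
      (add_le_add ((mem_restrictTotalDegree _ _ _).1 (g i.castSucc).2) (hd i))
  · rw [mem_restrictTotalDegree]
    refine (totalDegree_mul _ _).trans (add_le_add ((mem_restrictTotalDegree _ _ _).1 (g _).2) ?_)
    rw [totalDegree_X]; exact hd1

/-- `fibreMap₁` lands in degree `≤ E + d`. [folklore] -/
theorem fibreMap₁_mem (g : PencilSrc n s d K) :
    fibreMap₁ (s := s) d g ∈ restrictTotalDegree (Fin n) K (effNSBound n d + d) := by
  rw [fibreMap₁_apply, mem_restrictTotalDegree, totalDegree_neg]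
  exact ((mem_restrictTotalDegree _ _ _).1 (g _).2).trans (Nat.le_add_right _ _)

/-- The pencil `M₀ : g ↦ ∑ g_i S_i + g_s Y_j` into degree `≤ E + d`. [folklore] -/
def fibrePencil₀ (hd : ∀ i, (S i).totalDegree ≤ d) (hd1 : 1 ≤ d) :
    PencilSrc n s d K →ₗ[K] PencilTgt n d K :=
  LinearMap.codRestrict _ (fibreMap₀ S d j) (fibreMap₀_mem S d j hd hd1)

/-- The pencil `M₁ : g ↦ -g_s`. [folklore] -/
def fibrePencil₁ (n s d : ℕ) (K : Type*) [Field K] : PencilSrc n s d K →ₗ[K] PencilTgt n d K :=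
  LinearMap.codRestrict _ (fibreMap₁ d) (fibreMap₁_mem (s := s) d)

/-- `1` as an element of the target. [folklore] -/
def oneTgt (n d : ℕ) (K : Type*) [Field K] : PencilTgt n d K :=
  ⟨1, by rw [mem_restrictTotalDegree, totalDegree_one]; exact Nat.zero_le _⟩

/-- The pencil, evaluated. [folklore] -/
theorem pencil_apply_val (hd : ∀ i, (S i).totalDegree ≤ d) (hd1 : 1 ≤ d) (a : K)
    (g : PencilSrc n s d K) :
    (pencil (fibrePencil₀ S d j hd hd1) (fibrePencil₁ n s d K) a g : MvPolynomial (Fin n) K) =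
      ∑ i : Fin s, (g i.castSucc : MvPolynomial (Fin n) K) * S i +
        (g (Fin.last s) : MvPolynomial (Fin n) K) * (X j - C a) := by
  simp only [pencil, LinearMap.add_apply, LinearMap.smul_apply, Submodule.coe_add,
    Submodule.coe_smul, fibrePencil₀, fibrePencil₁, LinearMap.codRestrict_apply]
  rw [fibreMap₀_apply, fibreMap₁_apply, MvPolynomial.smul_eq_C_mul]
  ring

/-- **Fibre empty ⟺ `1 ∈ im M(a)`**: for `K` algebraically closed, the fibre `Z(S) ∩ {Y_j = a}`
is empty iff `1 = ∑ g_i S_i + g_s (Y_j - a)` with `deg g ≤ effNSBound n d`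
(`exists_sum_mul_eq_one_of_forall_exists_ne_zero`). [folklore] -/
theorem one_mem_range_fibrePencil_iff [IsAlgClosed K] (hd : ∀ i, (S i).totalDegree ≤ d)
    (hd1 : 1 ≤ d) (a : K) :
    oneTgt n d K ∈ LinearMap.range (pencil (fibrePencil₀ S d j hd hd1) (fibrePencil₁ n s d K) a) ↔
      ∀ x ∈ zeroSet S, x j ≠ a := by
  constructor
  · rintro ⟨g, hg⟩ x hx hxa
    have h := congrArg (fun w : PencilTgt n d K => eval x (w : MvPolynomial (Fin n) K)) hg
    simp only [pencil_apply_val, oneTgt, map_add, map_sum, map_mul, map_sub, eval_X, eval_C,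
      map_one] at h
    rw [mem_zeroSet] at hx
    simp [hx, hxa] at h
  · intro hempty
    haveI : Infinite K := IsAlgClosed.instInfinite
    -- the system `S, Y_j - a` has no common zero
    set S' : Fin (s + 1) → MvPolynomial (Fin n) K := Fin.snoc S (X j - C a) with hS'
    have hd' : ∀ i, (S' i).totalDegree ≤ d := by
      intro i
      refine Fin.lastCases ?_ (fun i => ?_) i
      · rw [hS', Fin.snoc_last]
        refine (totalDegree_sub _ _).trans (max_le ?_ ?_)
        · rw [totalDegree_X]; exact hd1
        · rw [totalDegree_C]; exact Nat.zero_le _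
      · rw [hS', Fin.snoc_castSucc]; exact hd i
    have hV : ∀ x : Fin n → K, ∃ i, aeval x (S' i) ≠ 0 := by
      intro x
      by_contra h
      push Not at h
      have hx : x ∈ zeroSet S := fun i => by
        have := h i.castSucc
        rw [hS', Fin.snoc_castSucc] at this
        exact this
      have hxa : x j = a := by
        have := h (Fin.last s)
        rw [hS', Fin.snoc_last] at this
        change eval x (X j - C a) = 0 at this
        rwa [map_sub, eval_X, eval_C, sub_eq_zero] at this
      exact hempty x hx hxa
    obtain ⟨g, hg1, hgdeg⟩ := exists_sum_mul_eq_one_of_forall_exists_ne_zero (K := K) S' hd' hV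
    refine ⟨fun i => ⟨g i, (mem_restrictTotalDegree _ _ _).2 (hgdeg i)⟩, ?_⟩
    apply Subtype.ext
    rw [pencil_apply_val]
    change _ = (1 : MvPolynomial (Fin n) K)
    rw [← hg1, Fin.sum_univ_castSucc, hS']
    simp only [Fin.snoc_castSucc, Fin.snoc_last]

/-- `dim (target) ≤ N`. [folklore] -/
theorem finrank_pencilTgt_le (n d : ℕ) (K : Type*) [Field K] :
    finrank K (PencilTgt n d K) ≤ projBound n d := by
  calc finrank K (PencilTgt n d K)
      ≤ finrank K ↥(restrictDegree (Fin n) K (effNSBound n d + d)) :=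
        Submodule.finrank_mono (restrictTotalDegree_le_restrictDegree _ _ _)
    _ = projBound n d := by rw [finrank_restrictDegree, Fintype.card_fin, projBound]

/-- **Projection dichotomy.** For `K` algebraically closed and `S_i` of degree `≤ d` (`d ≥ 1`):
either the `j`-th coordinates of the zeros of `S` form a set of at most `N = projBound n d`
elements, or all but at most `N` elements of `K` occur as `j`-th coordinate of a zero. [folklore] -/
theorem projection_dichotomy [IsAlgClosed K] (hd : ∀ i, (S i).totalDegree ≤ d) (hd1 : 1 ≤ d) :
    (∃ T : Finset K, T.card ≤ projBound n d ∧ ∀ x ∈ zeroSet S, x j ∈ T) ∨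
    (∃ T : Finset K, T.card ≤ projBound n d ∧ ∀ a, a ∉ T → ∃ x ∈ zeroSet S, x j = a) := by
  haveI : Infinite K := IsAlgClosed.instInfinite
  rcases rank_dichotomy (fibrePencil₀ S d j hd hd1) (fibrePencil₁ n s d K) (oneTgt n d K) with
    ⟨T, hT, h⟩ | ⟨T, hT, h⟩
  · left
    refine ⟨T, hT.trans (finrank_pencilTgt_le n d K), fun x hx => h _ fun hmem => ?_⟩
    exact (one_mem_range_fibrePencil_iff S d j hd hd1 (x j)).1 hmem x hx rfl
  · right
    refine ⟨T, hT.trans (finrank_pencilTgt_le n d K), fun a ha => ?_⟩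
    by_contra hne
    push Not at hne
    exact ha (h a ((one_mem_range_fibrePencil_iff S d j hd hd1 a).2 fun x hx hxa => hne x hx hxa))

end Pencil

/-! ### Fixing coordinates to small natural numbers -/

section Iterate

variable {n : ℕ}

/-- The `j`-th projection of `Z` has at most `N` elements. [folklore] -/
def SmallProj (Z : Set (Fin n → K)) (j : Fin n) (N : ℕ) : Prop :=
  ∃ T : Finset K, T.card ≤ N ∧ ∀ x ∈ Z, x j ∈ T

omit [Field K] in
/-- Smallness passes to subsets. [folklore] -/
theorem SmallProj.mono {Z Z' : Set (Fin n → K)} (h : Z' ⊆ Z)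
    {j : Fin n} {N : ℕ} (hZ : SmallProj Z j N) : SmallProj Z' j N := by
  obtain ⟨T, hT, hZ⟩ := hZ
  exact ⟨T, hT, fun x hx => hZ x (h hx)⟩

/-- The zero set of `S` extended by the constraints `Y_{js t} - as t`. [folklore] -/
theorem zeroSet_append {s m : ℕ} (S : Fin s → MvPolynomial (Fin n) K) (js : Fin m → Fin n)
    (as : Fin m → ℕ) :
    zeroSet (Fin.append S fun t => X (js t) - C ((as t : ℕ) : K)) =
      {x | x ∈ zeroSet S ∧ ∀ t, x (js t) = as t} := by
  ext x
  simp only [mem_zeroSet, Set.mem_setOf_eq]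
  constructor
  · intro h
    refine ⟨fun i => ?_, fun t => ?_⟩
    · have := h (Fin.castAdd m i); rwa [Fin.append_left] at this
    · have := h (Fin.natAdd s t)
      rwa [Fin.append_right, map_sub, eval_X, eval_C, sub_eq_zero] at this
  · rintro ⟨h1, h2⟩ i
    refine Fin.addCases (fun i => ?_) (fun t => ?_) i
    · rw [Fin.append_left]; exact h1 i
    · rw [Fin.append_right, map_sub, eval_X, eval_C, sub_eq_zero]; exact h2 t

/-- One more constraint. [folklore] -/
theorem zeroSet_snoc {s : ℕ} (S : Fin s → MvPolynomial (Fin n) K) (j : Fin n) (a : K) :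
    zeroSet (Fin.snoc S (X j - C a) : Fin (s + 1) → MvPolynomial (Fin n) K) =
      {x | x ∈ zeroSet S ∧ x j = a} := by
  ext x
  simp only [mem_zeroSet, Set.mem_setOf_eq]
  constructor
  · intro h
    refine ⟨fun i => ?_, ?_⟩
    · have := h i.castSucc; rwa [Fin.snoc_castSucc] at this
    · have := h (Fin.last s)
      rwa [Fin.snoc_last, map_sub, eval_X, eval_C, sub_eq_zero] at this
  · rintro ⟨h1, h2⟩ i
    refine Fin.lastCases ?_ (fun i => ?_) i
    · rw [Fin.snoc_last, map_sub, eval_X, eval_C, sub_eq_zero]; exact h2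
    · rw [Fin.snoc_castSucc]; exact h1 i

/-- **Fixing coordinates.** Let `K` be algebraically closed of characteristic zero,
`S_1, …, S_s ∈ K[Y_1, …, Y_n]` of degree `≤ d` (`d ≥ 1`) with a common zero. Then there are
`m ≤ n` constraints `Y_{j_t} = a_t` with natural numbers `a_t ≤ N = projBound n d` such that the
constrained zero set is nonempty and each of its coordinate projections has at most `N` elements.
(Induction on the number of coordinates with a large projection: such a coordinate misses at most
`N` values by `projection_dichotomy`, so one of `0, 1, …, N` is attained.) [folklore] -/
theorem exists_constraints_smallProj [IsAlgClosed K] [CharZero K] {d : ℕ} (hd1 : 1 ≤ d) :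
    ∀ (c s : ℕ) (S : Fin s → MvPolynomial (Fin n) K), (∀ i, (S i).totalDegree ≤ d) →
      (zeroSet S).Nonempty →
      (Finset.univ.filter fun j => ¬ SmallProj (zeroSet S) j (projBound n d)).card ≤ c →
      ∃ m : ℕ, m ≤ c ∧ ∃ (js : Fin m → Fin n) (as : Fin m → ℕ), (∀ t, as t ≤ projBound n d) ∧
        {x | x ∈ zeroSet S ∧ ∀ t, x (js t) = as t}.Nonempty ∧
        ∀ j, SmallProj {x | x ∈ zeroSet S ∧ ∀ t, x (js t) = as t} j (projBound n d) := by
  intro c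
  induction c with
  | zero =>
    intro s S hd hne hc
    refine ⟨0, le_rfl, Fin.elim0, Fin.elim0, fun t => t.elim0, ?_, fun j => ?_⟩
    · obtain ⟨x, hx⟩ := hne; exact ⟨x, hx, fun t => t.elim0⟩
    · have hj : SmallProj (zeroSet S) j (projBound n d) := by
        by_contra h
        have : j ∈ Finset.univ.filter fun j => ¬ SmallProj (zeroSet S) j (projBound n d) :=
          Finset.mem_filter.2 ⟨Finset.mem_univ _, h⟩
        rw [Nat.le_zero, Finset.card_eq_zero] at hc
        rw [hc] at this
        exact Finset.notMem_empty _ this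
      exact hj.mono fun x hx => hx.1
  | succ c ih =>
    intro s S hd hne hc
    by_cases hall : ∀ j, SmallProj (zeroSet S) j (projBound n d)
    · refine ⟨0, Nat.zero_le _, Fin.elim0, Fin.elim0, fun t => t.elim0, ?_, fun j => ?_⟩
      · obtain ⟨x, hx⟩ := hne; exact ⟨x, hx, fun t => t.elim0⟩
      · exact (hall j).mono fun x hx => hx.1
    push Not at hall
    obtain ⟨j₀, hj₀⟩ := hall
    -- the dichotomy for `j₀`: the projection misses at most `N` values
    rcases projection_dichotomy S d j₀ hd hd1 with ⟨T, hT, h⟩ | ⟨T, hT, h⟩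
    · exact absurd ⟨T, hT, h⟩ hj₀
    -- a natural number `a ≤ N` outside `T`
    obtain ⟨a, haN, haT⟩ : ∃ a : ℕ, a ≤ projBound n d ∧ ((a : ℕ) : K) ∉ T := by
      by_contra hcon
      push Not at hcon
      have hsub : (Finset.range (projBound n d + 1)).image (fun a : ℕ => (a : K)) ⊆ T := by
        intro x hx
        obtain ⟨a, ha, rfl⟩ := Finset.mem_image.1 hx
        exact hcon a (Nat.lt_succ_iff.1 (Finset.mem_range.1 ha))
      have hcard := Finset.card_le_card hsub
      rw [Finset.card_image_of_injective _ Nat.cast_injective, Finset.card_range] at hcard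
      omega
    obtain ⟨x₀, hx₀, hx₀j⟩ := h _ haT
    -- the new system
    set S₁ : Fin (s + 1) → MvPolynomial (Fin n) K := Fin.snoc S (X j₀ - C ((a : ℕ) : K)) with hS₁
    have hd₁ : ∀ i, (S₁ i).totalDegree ≤ d := by
      intro i
      refine Fin.lastCases ?_ (fun i => ?_) i
      · rw [hS₁, Fin.snoc_last]
        refine (totalDegree_sub _ _).trans (max_le ?_ ?_)
        · rw [totalDegree_X]; exact hd1
        · rw [totalDegree_C]; exact Nat.zero_le _
      · rw [hS₁, Fin.snoc_castSucc]; exact hd i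
    have hZ₁ : zeroSet S₁ = {x | x ∈ zeroSet S ∧ x j₀ = a} := zeroSet_snoc S j₀ _
    have hne₁ : (zeroSet S₁).Nonempty := ⟨x₀, by rw [hZ₁]; exact ⟨hx₀, hx₀j⟩⟩
    have hsub₁ : zeroSet S₁ ⊆ zeroSet S := by rw [hZ₁]; exact fun x hx => hx.1
    -- fewer large projections
    have hc₁ : (Finset.univ.filter fun j => ¬ SmallProj (zeroSet S₁) j (projBound n d)).card ≤ c := by
      have hss : (Finset.univ.filter fun j => ¬ SmallProj (zeroSet S₁) j (projBound n d)) ⊂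
          (Finset.univ.filter fun j => ¬ SmallProj (zeroSet S) j (projBound n d)) := by
        rw [Finset.ssubset_iff_of_subset]
        · refine ⟨j₀, Finset.mem_filter.2 ⟨Finset.mem_univ _, hj₀⟩, fun hmem => ?_⟩
          refine (Finset.mem_filter.1 hmem).2 ⟨{((a : ℕ) : K)}, ?_, fun x hx => ?_⟩
          · rw [Finset.card_singleton]; exact Nat.one_le_iff_ne_zero.2 (by
              unfold projBound; positivity)
          · rw [hZ₁] at hx; rw [Finset.mem_singleton]; exact hx.2
        · intro j hj
          rw [Finset.mem_filter] at hj ⊢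
          exact ⟨hj.1, fun hsm => hj.2 (hsm.mono hsub₁)⟩
      have := Finset.card_lt_card hss
      omega
    obtain ⟨m, hm, js, as, has, hne', hsmall⟩ := ih (s + 1) S₁ hd₁ hne₁ hc₁
    -- assemble
    have hset : {x | x ∈ zeroSet S ∧ ∀ t, x ((Fin.cons j₀ js : Fin (m + 1) → Fin n) t) =
        ((Fin.cons a as : Fin (m + 1) → ℕ) t : K)} = {x | x ∈ zeroSet S₁ ∧ ∀ t, x (js t) = as t} := by
      ext x
      simp only [Set.mem_setOf_eq, hZ₁, Fin.forall_fin_succ, Fin.cons_zero, Fin.cons_succ]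
      tauto
    refine ⟨m + 1, by omega, Fin.cons j₀ js, Fin.cons a as, fun t => ?_, ?_, fun j => ?_⟩
    · refine Fin.cases ?_ (fun t => ?_) t
      · simpa using haN
      · simpa using has t
    · rw [hset]; exact hne'
    · rw [hset]; exact hsmall j

end Iterate

end Literature.RingTheory.Nullstellensatz

end
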